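import Summits.FinalStateConjecture.FinalStateConjecture.Theorems.EIHFluxBalanceInertialRecessionBoostAlgebra
import Mathlib.Analysis.Calculus.InverseFunctionTheorem.FDeriv

/-!
# Route EIHFluxBalance — `InertialRecession`: fibred self-maps of `E4` as open embeddings

Helper file for the crux `stmt-FinalStateConjecture-10166`
(`Summit.FinalStateConjecture.FinalStateConjecture.Theses.EIHFluxBalance.InertialRecession`).

The hole charts of the re-charting are `Φ ∘ A` with `A : E4 → E4` a composite of maps of two
shapes: time reparametrisations `y ↦ (θ(y⁰), y̲)` and maps fibred over time
`y ↦ (y⁰, g(y⁰, y̲))` (clamping the rest offset, then placing it at `ξ(t) + L_{v(t)} z`). To be a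
late-time CHART, `Φ ∘ A` must be an open embedding on the late region; since `Φ` is one, it
suffices that `A` is an open embedding of `E4` into itself. This file proves the criterion and
checks it for the building blocks:

* `isOpenEmbedding_of_injective_of_fderiv_injective` — a `C¹` injective self-map of `E4` all of
  whose differentials are injective is an open embedding (inverse function theorem);
* `isOpenEmbedding_timeReparam` — `y ↦ (θ(y⁰), y̲)` for `θ` smooth with `θ' > 0`;
* `hasFDerivAt_fibred`, `isOpenEmbedding_fibred'` (registered form unprimed) — `y ↦ (y⁰, g(y⁰, y̲))` for `g` jointly `C¹`,
  fibrewise injective with fibrewise injective differentials;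
* `isOpenEmbedding_restPlacement'` (registered form unprimed) — the instance `g(t, z) = ξ(t) + L_{v(t)} z`;
* `isOpenEmbedding_labRest` — the linear instance `x' ↦ (x'⁰, (Λ⁻¹x')~)` for a boost `Λ`.
-/

noncomputable section

open scoped Topology ContDiff InnerProductSpace
open Filter Set Metric Function TopologicalSpace Literature.Geometry.Lorentzian

namespace Summit.FinalStateConjecture.FinalStateConjecture.Theorems

/-! ### The open-embedding criterion -/

/-- **Inverse function theorem, global form used here.** A `C¹` injective map `f : E4 → E4` all
of whose differentials are injective (hence invertible) is an open embedding. [folklore] -/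
theorem isOpenEmbedding_of_injective_of_fderiv_injective {f : E4 → E4} {n : WithTop ℕ∞}
    (hf : ContDiff ℝ n f) (hn : n ≠ 0) (hinj : Injective f)
    (hD : ∀ x, Injective (fderiv ℝ f x)) : Topology.IsOpenEmbedding f := by
  have hopen : IsOpenMap f := by
    refine isOpenMap_iff_nhds_le.mpr fun x ↦ ?_
    set L : E4 →L[ℝ] E4 := fderiv ℝ f x with hL
    have hbij : Bijective (L : E4 →ₗ[ℝ] E4) :=
      ⟨hD x, LinearMap.injective_iff_surjective.mp (hD x)⟩
    let e : E4 ≃L[ℝ] E4 := (LinearEquiv.ofBijective (L : E4 →ₗ[ℝ] E4) hbij).toContinuousLinearEquiv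
    have he : (e : E4 →L[ℝ] E4) = L := by
      ext v
      rfl
    have hstrict : HasStrictFDerivAt f (e : E4 →L[ℝ] E4) x := by
      rw [he]
      exact hf.contDiffAt.hasStrictFDerivAt hn
    exact (hstrict.map_nhds_eq_of_equiv).ge
  exact .of_continuous_injective_isOpenMap hf.continuous hinj hopen

/-! ### Splitting `E4 = ℝ × E3` -/

/-- `y = (y⁰) e₀ + (0, y̲)`. [folklore] -/
theorem eq_smul_basisVector_add_spaceEmbed (y : E4) :
    y = (y 0) • E4.basisVector 0 + E4.spaceEmbed (E4.spatial y) := by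
  conv_lhs => rw [← E4.ofTimeSpace_time_spatial y]
  exact E4.ofTimeSpace_eq_smul_add' _ _

/-- `(0, z)⁰ = 0`, `(0, z)~ = z`: a vector `(s) e₀ + (0, z)` vanishes iff `s = 0` and `z = 0`.
[folklore] -/
theorem smul_basisVector_add_spaceEmbed_eq_zero {s : ℝ} {z : E3}
    (h : s • E4.basisVector 0 + E4.spaceEmbed z = 0) : s = 0 ∧ z = 0 := by
  have h1 : E4.ofTimeSpace s z = 0 := by rw [E4.ofTimeSpace_eq_smul_add']; exact h
  have hs : s = 0 := by
    have := congrArg (fun x : E4 ↦ x 0) h1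
    simpa using this
  have hz : z = 0 := by
    have := congrArg E4.spatial h1
    simpa using this
  exact ⟨hs, hz⟩

/-! ### Time reparametrisations -/

/-- `y ↦ (θ(y⁰), y̲)` is an open embedding of `E4` when `θ` is smooth with `θ' > 0`. [folklore] -/
theorem isOpenEmbedding_timeReparam {θ : ℝ → ℝ} (hθ : ContDiff ℝ ∞ θ) (hθ' : ∀ w, 0 < deriv θ w) :
    Topology.IsOpenEmbedding fun y : E4 ↦ E4.ofTimeSpace (θ (y 0)) (E4.spatial y) := by
  have hmono : StrictMono θ := strictMono_of_deriv_pos hθ'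
  have h0 : ContDiff ℝ ∞ fun y : E4 ↦ y 0 := (EuclideanSpace.proj (0 : Fin 4) : E4 →L[ℝ] ℝ).contDiff
  have hfun : (fun y : E4 ↦ E4.ofTimeSpace (θ (y 0)) (E4.spatial y)) =
      fun y ↦ (θ (y 0)) • E4.basisVector 0 + E4.spaceEmbed (E4.spatial y) :=
    funext fun y ↦ E4.ofTimeSpace_eq_smul_add' _ _
  have hcd : ContDiff ℝ ∞ fun y : E4 ↦ E4.ofTimeSpace (θ (y 0)) (E4.spatial y) := by
    rw [hfun]
    exact ((hθ.comp h0).smul contDiff_const).add (E4.spaceEmbed.contDiff.comp E4.spatial.contDiff)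
  refine isOpenEmbedding_of_injective_of_fderiv_injective hcd (by simp) ?_ ?_
  · intro y y' h
    have h1 : θ (y 0) = θ (y' 0) := by
      have := congrArg (fun x : E4 ↦ x 0) h; simpa using this
    have h2 : E4.spatial y = E4.spatial y' := by
      have := congrArg E4.spatial h; simpa using this
    have h3 : y 0 = y' 0 := hmono.injective h1
    rw [← E4.ofTimeSpace_time_spatial y, ← E4.ofTimeSpace_time_spatial y', E4.time_apply,
      E4.time_apply, h3, h2]
  · intro y
    -- the differential is `δ ↦ θ'(y⁰) δ⁰ e₀ + (0, δ̲)`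
    have hθd : HasDerivAt θ (deriv θ (y 0)) (y 0) := (hθ.differentiable (by simp) _).hasDerivAt
    have hd0 : HasFDerivAt (fun y : E4 ↦ y 0) (EuclideanSpace.proj (0 : Fin 4) : E4 →L[ℝ] ℝ) y :=
      (EuclideanSpace.proj (0 : Fin 4) : E4 →L[ℝ] ℝ).hasFDerivAt
    have hd1 : HasFDerivAt (fun y : E4 ↦ θ (y 0))
        ((ContinuousLinearMap.smulRight (1 : ℝ →L[ℝ] ℝ) (deriv θ (y 0))).comp
          (EuclideanSpace.proj (0 : Fin 4) : E4 →L[ℝ] ℝ)) y :=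
      hθd.hasFDerivAt.comp y hd0
    have hd2 : HasFDerivAt (fun y : E4 ↦ (θ (y 0)) • E4.basisVector 0 + E4.spaceEmbed (E4.spatial y))
        (((ContinuousLinearMap.smulRight (1 : ℝ →L[ℝ] ℝ) (deriv θ (y 0))).comp
          (EuclideanSpace.proj (0 : Fin 4) : E4 →L[ℝ] ℝ)).smulRight
          (E4.basisVector 0) + E4.spaceEmbed.comp E4.spatial) y :=
      (hd1.smul_const _).add ((E4.spaceEmbed.comp E4.spatial).hasFDerivAt)
    rw [hfun, hd2.fderiv]
    intro δ δ' hδ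
    rw [← sub_eq_zero] at hδ ⊢
    rw [← map_sub] at hδ
    set d := δ - δ' with hd
    have hδ' : (d 0 * deriv θ (y 0)) • E4.basisVector 0 + E4.spaceEmbed (E4.spatial d) = 0 := by
      simpa using hδ
    obtain ⟨h1, h2⟩ := smul_basisVector_add_spaceEmbed_eq_zero hδ'
    have h3 : d 0 = 0 := by
      rcases mul_eq_zero.mp h1 with h | h
      · exact h
      · exact absurd h (hθ' (y 0)).ne'
    rw [eq_smul_basisVector_add_spaceEmbed d, h3, h2, zero_smul, map_zero, add_zero]

/-! ### Maps fibred over time -/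

/-- The differential of `y ↦ (y⁰, g(y⁰, y̲))`:
`δ ↦ δ⁰ e₀ + (0, Dg(y⁰, y̲)(δ⁰, δ̲))`. [folklore] -/
theorem hasFDerivAt_fibred {g : ℝ → E3 → E3} {g' : ℝ × E3 →L[ℝ] E3} {y : E4}
    (hg : HasFDerivAt (fun p : ℝ × E3 ↦ g p.1 p.2) g' (y 0, E4.spatial y)) :
    HasFDerivAt (fun y : E4 ↦ E4.ofTimeSpace (y 0) (g (y 0) (E4.spatial y)))
      ((EuclideanSpace.proj (0 : Fin 4) : E4 →L[ℝ] ℝ).smulRight (E4.basisVector 0) +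
        E4.spaceEmbed.comp (g'.comp ((EuclideanSpace.proj (0 : Fin 4) : E4 →L[ℝ] ℝ).prod
          E4.spatial))) y := by
  have hfun : (fun y : E4 ↦ E4.ofTimeSpace (y 0) (g (y 0) (E4.spatial y))) =
      fun y ↦ (y 0) • E4.basisVector 0 + E4.spaceEmbed (g (y 0) (E4.spatial y)) :=
    funext fun y ↦ E4.ofTimeSpace_eq_smul_add' _ _
  rw [hfun]
  have hd0 : HasFDerivAt (fun y : E4 ↦ y 0) (EuclideanSpace.proj (0 : Fin 4) : E4 →L[ℝ] ℝ) y :=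
    (EuclideanSpace.proj (0 : Fin 4) : E4 →L[ℝ] ℝ).hasFDerivAt
  have hp : HasFDerivAt (fun y : E4 ↦ (y 0, E4.spatial y))
      ((EuclideanSpace.proj (0 : Fin 4) : E4 →L[ℝ] ℝ).prod E4.spatial) y :=
    hd0.prodMk E4.spatial.hasFDerivAt
  have hg' := hg.comp y hp
  exact (hd0.smul_const _).add (E4.spaceEmbed.hasFDerivAt.comp y hg')

/-- The fibre derivative: `Dg(t, z)(0, δ) = D(g t)(z) δ`. [folklore] -/
theorem fderiv_fibre_apply {g : ℝ → E3 → E3} {t : ℝ} {z : E3}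
    (hg : DifferentiableAt ℝ (fun p : ℝ × E3 ↦ g p.1 p.2) (t, z)) (δ : E3) :
    fderiv ℝ (g t) z δ = fderiv ℝ (fun p : ℝ × E3 ↦ g p.1 p.2) (t, z) (0, δ) := by
  have h1 : HasFDerivAt (fun z' : E3 ↦ (t, z')) (ContinuousLinearMap.inr ℝ ℝ E3) z :=
    hasFDerivAt_prodMk_right t z
  have h2 := hg.hasFDerivAt.comp z h1
  have h3 : (fun p : ℝ × E3 ↦ g p.1 p.2) ∘ (fun z' : E3 ↦ (t, z')) = g t := rfl
  rw [h3] at h2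
  rw [h2.fderiv]
  rfl

/-- **Fibred maps are open embeddings.** If `g : ℝ → E3 → E3` is jointly smooth, each fibre map
`g t` is injective and each fibre differential `D(g t)(z)` is injective, then
`y ↦ (y⁰, g(y⁰, y̲))` is an open embedding of `E4`. [folklore] -/
theorem isOpenEmbedding_fibred' {g : ℝ → E3 → E3} (hg : ContDiff ℝ ∞ fun p : ℝ × E3 ↦ g p.1 p.2)
    (hinj : ∀ t, Injective (g t)) (hD : ∀ t z, Injective (fderiv ℝ (g t) z)) :
    Topology.IsOpenEmbedding fun y : E4 ↦ E4.ofTimeSpace (y 0) (g (y 0) (E4.spatial y)) := by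
  have h0 : ContDiff ℝ ∞ fun y : E4 ↦ y 0 := (EuclideanSpace.proj (0 : Fin 4) : E4 →L[ℝ] ℝ).contDiff
  have hfun : (fun y : E4 ↦ E4.ofTimeSpace (y 0) (g (y 0) (E4.spatial y))) =
      fun y ↦ (y 0) • E4.basisVector 0 + E4.spaceEmbed (g (y 0) (E4.spatial y)) :=
    funext fun y ↦ E4.ofTimeSpace_eq_smul_add' _ _
  have hcd : ContDiff ℝ ∞ fun y : E4 ↦ E4.ofTimeSpace (y 0) (g (y 0) (E4.spatial y)) := by
    rw [hfun]
    exact (h0.smul contDiff_const).add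
      (E4.spaceEmbed.contDiff.comp (hg.comp (h0.prodMk E4.spatial.contDiff)))
  refine isOpenEmbedding_of_injective_of_fderiv_injective hcd (by simp) ?_ ?_
  · intro y y' h
    have h1 : y 0 = y' 0 := by
      have := congrArg (fun x : E4 ↦ x 0) h; simpa using this
    have h2 : g (y 0) (E4.spatial y) = g (y' 0) (E4.spatial y') := by
      have := congrArg E4.spatial h; simpa using this
    rw [h1] at h2
    have h3 : E4.spatial y = E4.spatial y' := hinj _ h2
    rw [← E4.ofTimeSpace_time_spatial y, ← E4.ofTimeSpace_time_spatial y', E4.time_apply,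
      E4.time_apply, h1, h3]
  · intro y
    have hgd : DifferentiableAt ℝ (fun p : ℝ × E3 ↦ g p.1 p.2) (y 0, E4.spatial y) :=
      (hg.differentiable (by simp)).differentiableAt
    rw [(hasFDerivAt_fibred hgd.hasFDerivAt).fderiv]
    intro δ δ' hδ
    rw [← sub_eq_zero] at hδ ⊢
    rw [← map_sub] at hδ
    set d := δ - δ' with hd
    have hδ' : (d 0) • E4.basisVector 0 +
        E4.spaceEmbed (fderiv ℝ (fun p : ℝ × E3 ↦ g p.1 p.2) (y 0, E4.spatial y)
          (d 0, E4.spatial d)) = 0 := by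
      simpa using hδ
    obtain ⟨h1, h2⟩ := smul_basisVector_add_spaceEmbed_eq_zero hδ'
    rw [h1, ← fderiv_fibre_apply hgd] at h2
    have h3 : E4.spatial d = 0 := by
      have := hD (y 0) (E4.spatial y) (a₁ := E4.spatial d) (a₂ := 0) (by rw [h2, map_zero])
      exact this
    rw [eq_smul_basisVector_add_spaceEmbed d, h1, h3, zero_smul, map_zero, add_zero]

/-! ### The rest placement `(t, z) ↦ ξ(t) + L_{v(t)} z` -/

/-- **The rest placement is an open embedding**: for smooth `ξ`, `v` with `‖v‖ < 1`,
`y ↦ (y⁰, ξ(y⁰) + L_{v(y⁰)} y̲)` is an open embedding of `E4` (each fibre is the affine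
isomorphism `z ↦ ξ + L_v z`, `L_v⁻¹ = P_v`). [folklore] -/
theorem isOpenEmbedding_restPlacement' {ξ v : ℝ → E3} (hξ : ContDiff ℝ ∞ ξ) (hv : ContDiff ℝ ∞ v)
    (hv1 : ∀ t, ‖v t‖ < 1) :
    Topology.IsOpenEmbedding fun y : E4 ↦ E4.ofTimeSpace (y 0) (ξ (y 0) +
      (E4.spatial y - (Lorentz.gamma (v (y 0)) / (Lorentz.gamma (v (y 0)) + 1) *
        inner ℝ (v (y 0)) (E4.spatial y)) • v (y 0))) := by
  set Lf : E3 → E3 →L[ℝ] E3 := fun u ↦ ContinuousLinearMap.id ℝ E3 -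
    (Lorentz.gamma u / (Lorentz.gamma u + 1)) • (innerSL ℝ u).smulRight u with hLf
  have hLa : ∀ u z, Lf u z = z - (Lorentz.gamma u / (Lorentz.gamma u + 1) * inner ℝ u z) • u :=
    fun u z ↦ restOffsetCLM_apply u z
  set g : ℝ → E3 → E3 := fun t z ↦ ξ t + Lf (v t) z with hgdef
  have hfun : (fun y : E4 ↦ E4.ofTimeSpace (y 0) (ξ (y 0) +
      (E4.spatial y - (Lorentz.gamma (v (y 0)) / (Lorentz.gamma (v (y 0)) + 1) *
        inner ℝ (v (y 0)) (E4.spatial y)) • v (y 0)))) =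
      fun y ↦ E4.ofTimeSpace (y 0) (g (y 0) (E4.spatial y)) := by
    funext y
    simp only [hgdef, hLa]
  rw [hfun]
  -- joint smoothness of `g`
  have hLv : ContDiff ℝ ∞ fun t ↦ Lf (v t) := by
    have hmaps : ∀ t, v t ∈ ball (0 : E3) 1 := fun t ↦ by simpa using hv1 t
    refine contDiff_iff_contDiffAt.mpr fun t ↦ ?_
    exact ((contDiffOn_restOffsetCLM (v t) (hmaps t)).contDiffAt
      (isOpen_ball.mem_nhds (hmaps t))).comp t hv.contDiffAt
  have hg : ContDiff ℝ ∞ fun p : ℝ × E3 ↦ g p.1 p.2 := by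
    show ContDiff ℝ ∞ fun p : ℝ × E3 ↦ ξ p.1 + Lf (v p.1) p.2
    exact (hξ.comp contDiff_fst).add ((hLv.comp contDiff_fst).clm_apply contDiff_snd)
  refine isOpenEmbedding_fibred' hg (fun t ↦ ?_) (fun t z ↦ ?_)
  · intro z z' h
    have h1 : Lf (v t) z = Lf (v t) z' := add_left_cancel h
    rw [hLa, hLa] at h1
    have := congrArg (fun w : E3 ↦ w + (Lorentz.gamma (v t) ^ 2 / (Lorentz.gamma (v t) + 1) *
      inner ℝ (v t) w) • v t) h1
    rwa [restOffset_leftInverse (hv1 t), restOffset_leftInverse (hv1 t)] at this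
  · have hd : HasFDerivAt (g t) (Lf (v t)) z := by
      show HasFDerivAt (fun z ↦ ξ t + Lf (v t) z) (Lf (v t)) z
      exact ((Lf (v t)).hasFDerivAt).const_add (ξ t)
    rw [hd.fderiv]
    intro z z' h
    have h1 : Lf (v t) z = Lf (v t) z' := h
    rw [hLa, hLa] at h1
    have := congrArg (fun w : E3 ↦ w + (Lorentz.gamma (v t) ^ 2 / (Lorentz.gamma (v t) + 1) *
      inner ℝ (v t) w) • v t) h1
    rwa [restOffset_leftInverse (hv1 t), restOffset_leftInverse (hv1 t)] at this

/-! ### The linear map `x' ↦ (x'⁰, (Λ⁻¹ x')~)` -/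

/-- For a boost `Λ = boost V`, `x' ↦ (x'⁰, (Λ⁻¹x')~)` is an open embedding of `E4` (an injective
linear map: `x'⁰ = γ(y⁰ + ⟪V, y̲⟫)` and `y̲` determine `y = Λ⁻¹ x'`). [folklore] -/
theorem isOpenEmbedding_labRest {V : E3} (hV : ‖V‖ < 1) :
    Topology.IsOpenEmbedding fun x : E4 ↦ E4.ofTimeSpace (x 0)
      (E4.spatial ((Lorentz.boost V hV : E4 ≃L[ℝ] E4).symm x)) := by
  set Λ : E4 ≃L[ℝ] E4 := (Lorentz.boost V hV : E4 ≃L[ℝ] E4) with hΛ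
  set T : E4 →L[ℝ] E4 := (EuclideanSpace.proj (0 : Fin 4) : E4 →L[ℝ] ℝ).smulRight
    (E4.basisVector 0) + E4.spaceEmbed.comp (E4.spatial.comp (Λ.symm : E4 →L[ℝ] E4)) with hT
  have hfun : (fun x : E4 ↦ E4.ofTimeSpace (x 0) (E4.spatial (Λ.symm x))) = T := by
    funext x
    rw [E4.ofTimeSpace_eq_smul_add']
    simp [hT]
  rw [hfun]
  have hTinj : Injective T := by
    refine (injective_iff_map_eq_zero T).mpr fun x hx ↦ ?_
    have hx' : (x 0) • E4.basisVector 0 + E4.spaceEmbed (E4.spatial (Λ.symm x)) = 0 := by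
      simpa [hT] using hx
    obtain ⟨h1, h2⟩ := smul_basisVector_add_spaceEmbed_eq_zero hx'
    set y := Λ.symm x with hy
    have hxy : x = Λ y := (Λ.apply_symm_apply x).symm
    have h3 : x 0 = Lorentz.gamma V * (y 0 + inner ℝ V (E4.spatial y)) := by
      rw [hxy, hΛ, Lorentz.coe_boost_apply, Lorentz.boostCLM_apply_zero]
    rw [h2, inner_zero_right, add_zero, h1] at h3
    have hγ := Lorentz.gamma_pos hV
    have hy0 : y 0 = 0 := by
      rcases mul_eq_zero.mp h3.symm with h | h
      · exact absurd h hγ.ne'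
      · exact h
    have hy' : y = 0 := by
      rw [← E4.ofTimeSpace_time_spatial y, E4.time_apply, hy0, h2, E4.ofTimeSpace_eq_smul_add',
        zero_smul, zero_add, map_zero]
    rw [hxy, hy', map_zero]
  refine isOpenEmbedding_of_injective_of_fderiv_injective T.contDiff (n := 1) one_ne_zero hTinj
    fun x ↦ ?_
  rw [T.fderiv]
  exact hTinj

/-! ### Registered forms -/

/-- Registered sub-goal form (stub `isOpenEmbedding_fibred` of the crux item) of
`isOpenEmbedding_fibred'`. [folklore] -/
theorem isOpenEmbedding_fibred : ∀ {g : ℝ → E3 → E3}, ContDiff ℝ ((⊤ : ℕ∞) : WithTop ℕ∞) (fun p : ℝ × E3 ↦ g p.1 p.2) → (∀ t, Function.Injective (g t)) → (∀ t z, Function.Injective (fderiv ℝ (g t) z)) → Topology.IsOpenEmbedding fun y : E4 ↦ E4.ofTimeSpace (y 0) (g (y 0) (E4.spatial y)) :=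
  fun hg hinj hD ↦ isOpenEmbedding_fibred' hg hinj hD

/-- Registered sub-goal form (stub `isOpenEmbedding_restPlacement` of the crux item) of
`isOpenEmbedding_restPlacement'`. [folklore] -/
theorem isOpenEmbedding_restPlacement : open Literature.Geometry.Lorentzian in ∀ {ξ v : ℝ → E3}, ContDiff ℝ ((⊤ : ℕ∞) : WithTop ℕ∞) ξ → ContDiff ℝ ((⊤ : ℕ∞) : WithTop ℕ∞) v → (∀ t, ‖v t‖ < 1) → Topology.IsOpenEmbedding fun y : E4 ↦ E4.ofTimeSpace (y 0) (ξ (y 0) + (E4.spatial y - (Lorentz.gamma (v (y 0)) / (Lorentz.gamma (v (y 0)) + 1) * inner ℝ (v (y 0)) (E4.spatial y)) • v (y 0))) :=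
  fun hξ hv hv1 ↦ isOpenEmbedding_restPlacement' hξ hv hv1

end Summit.FinalStateConjecture.FinalStateConjecture.Theorems

end
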